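import Literature.NumberTheory.Rogawski1990.ArchOrbFamGUnfoldedModel            -- ★ (A5a) p851098 (F0P3b-p01 (g16)): `orbFamG_eq_unfoldedModel_of_regG`
import Literature.NumberTheory.Automorphic.ArchInnerFormChartOrbLocal            -- ★ `compactSpace_chartTorusGLoc_of_not_mem`; ★ `InvariantQuotientCompactSubgroup` (`quotientMeasure_eq_inv_smul_map_mk`)
import Mathlib.MeasureTheory.Measure.WithDensity                                 -- Mathlib `Measure.prod_smul_right`
import HarnessLib

/-!
# (A5a) with ONE compact place isolated: the unfolded model of `orbFamG` on the `G`-regular set as a WHOLE-GROUP orbital integral at `w₀ ∉ S′` of the partial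
# unfolded model over the other places («(J2-a) ISOLATION IN THE UNFOLDED CURRENCY»; Rogawski 1990 §4.9, §8.2–8.3; Folland 1995 §2.6 (2.52))

Topic `NumberTheory/Rogawski1990`; namespace `Literature.NumberTheory.Rogawski1990`.  THEOREMS ONLY (no `def`, no instance, no notation, no axiom, no named fact, no `sorry`).
Cell `pub/hodgecm-mathlib`, crux H413 (`stmt-HodgeConjecture-24833`), F0∕P3c line LH3 (closer stub `stub_N9`, leaf `F0_P3c_StubN9Direct` v6), organ O-L1d «HC-CENTRAL ∕ pure
scalar corners», brick **(J2-a)** of the (B3-JUNCTION) J2 cut of A-p12 (g28) (CALL BY NAME 2026-09-02T11:29:26Z; LH3-plan (g4) routing 11:36:07Z), seat F0P3a-p07 (g18).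
Count-neutral measure-theoretic bookkeeping: nothing here closes an organ.

THE MATHEMATICS.  ★ (A5a) `orbFamG_eq_unfoldedModel_of_regG` writes the raw family on `RegG S′` as
`orbFamG ν′ a′ S′ c = (cpt factors) · (∏ t_w(B′_w)) · (∏ C_w) · ∫ a′(e⁻¹(w ↦ [w ∈ S′] split word(k_w, n_w; c_w) ∣ [w ∉ S′] (g γ_cpt(c) g⁻¹)_w)) d((⊗_{S′} κ⊗μ_N) ⊗ ((⊗_{w∉S′} ν′_w) ∕ ρ_cpt))`,
the compact places read through ONE quotient `(Π_{w∉S′} U_w) ⧸ Π_{w∉S′} T′_w`.  At the compact places the local chart tori `T′_w` are compact (★ `compactSpace_chartTorusGLoc_of_not_mem`),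
so `Π T′_w` is compact and the invariant quotient measure is `ρ_cpt(Π T′)⁻¹ · π_*(⊗ ν′_w)` (★ `quotientMeasure_eq_inv_smul_map_mk`); unfolding it, splitting
`Π_{w∉S′} U_w ≃ U_{w₀} × Π_{w∉S′, w≠w₀} U_w` (Mathlib `piEquivPiSubtypeProd (· = ⟨w₀,_⟩)` + `piUnique`, INLINE as in ★ `ArchTorusOrbitalFubini` §3 ∕ ★ (J-iso) `ArchChartOrbGIsolatePlace`)
and Fubini give, for `c ∈ RegG S′` and `w₀ ∉ S′`:
**`orbFamG ν′ a′ S′ c = (cpt factors) · (∏ t_w(B′_w)) · (∏ C_w) · ρ_cpt(Π T′)⁻¹ · ∫_{U_{w₀}} ( ∫ a′(e⁻¹(w ↦ [w ∈ S′] split word ∣ [w = w₀] g·γ_{w₀}(c)·g⁻¹ ∣ [w ∉ S′, w ≠ w₀] r_w·γ_w(c)·r_w⁻¹))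
d((⊗_{S′} κ⊗μ_N) ⊗ (⊗_{w∉S′,w≠w₀} ν′_w))(s, r) ) dν′_{w₀}(g)`** — the `w₀`-place is a WHOLE-GROUP orbital integral of the partial UNFOLDED model over the other places (split places in
their `K × N` chart with every `Δ_w` absorbed, hence smooth across the real walls; compact places `≠ w₀` conjugation-read), which is what the (B3-JUNCTION) head J1
`exists_nhds_bddAbove_norm_iteratedFDeriv_orbFamGExt_of_centralModel` consumes as its `hfac` (after (J2-b)∕(J2-c) of A-p12 (g28)).
§1 states it under the `Integrable` binder of the final integrand (the iterated integral needs it; the change of variables does not); its discharge at `a′ ∈ C_c(G′_∞)` from the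
uniform properness of the `K × N` reading and of the compact-place conjugations ((J2-b′) lemmas, LH1-p03 (g6)) is a separate edition.
HONEST LABEL: HC_CM is proved only modulo the 7 printed citations (2 remaining: hLiu418 = `stmt-HodgeConjecture-24832`, h413 = `stmt-HodgeConjecture-24833`) until rung 0 closes.

## References
* [Rogawski1990] J. D. Rogawski, *Automorphic Representations of Unitary Groups in Three Variables*, Ann. of Math. Stud. 123 (1990), §4.9 (4.9.1)–(4.9.2) p. 55; §8.2 p. 122;
  §8.3 p. 124 (orbital integrals place by place).
* [Folland1995] G. B. Folland, *A Course in Abstract Harmonic Analysis* (1995), §2.2 (product measures), §2.6 Thm. 2.49, (2.52) (quotient integral formula, compact subgroup).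
* [BorelJacquet1979] A. Borel, H. Jacquet, *Automorphic forms and automorphic representations*, PSPM 33.1 (1979), §4.1 (`G_∞ = Π_v G(F_v)`, product measures).
* [DeitmarEchterhoff2014] A. Deitmar, S. Echterhoff, *Principles of Harmonic Analysis*, 2nd ed. (2014), Thm. 1.5.3, Cor. 1.5.4, Lemma 9.3.3.
-/

set_option autoImplicit false

noncomputable section

open MeasureTheory MeasureTheory.Measure Set NumberField NumberField.InfinitePlace Complex Topology
open Literature.MeasureTheory.Group Literature.NumberTheory.Automorphic Literature.NumberTheory.Automorphic.UnitaryGroup Literature.NumberTheory.Automorphic.ArchCartan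
open scoped ContDiff Classical ENNReal NNReal MatrixGroups

namespace Literature.NumberTheory.Rogawski1990

/-- The inverse of Mathlib's `piEquivPiSubtypeProd`, read componentwise (definitional; as in ★ `ArchTorusOrbitalFubini` §4). [cite: BorelJacquet1979, §4.1] -/
private theorem piEquivPiSubtypeProd_symm_apply_dite' {ι : Type*} (π : ι → Type*) [∀ i, MeasurableSpace (π i)] (p : ι → Prop)
    [DecidablePred p] (a : ∀ i : Subtype p, π i) (b : ∀ i : {i // ¬ p i}, π i) (i : ι) :
    (MeasurableEquiv.piEquivPiSubtypeProd π p).symm (a, b) i = if h : p i then a ⟨i, h⟩ else b ⟨i, h⟩ := rfl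

/-- The inverse of Mathlib's `piUnique` over the singleton `{j ∣ j = i₀}`, read at `i₀` (as in ★ `ArchTorusOrbitalFubini` §4). [cite: BorelJacquet1979, §4.1] -/
private theorem piUnique_symm_apply_of_eq' {ι : Type*} (π : ι → Type*) [∀ i, MeasurableSpace (π i)] (i₀ : ι) (x : π i₀) {h : i₀ = i₀} :
    (MeasurableEquiv.piUnique fun i : {i // i = i₀} => π i.1).symm x ⟨i₀, h⟩ = x :=
  uniqueElim_default (α := fun i : {i // i = i₀} => π i.1) x

section Isolate

variable (L : Type) [Field L] [NumberField L] [IsCMField L] (α : Fin 3 → L) (S' : Finset {w : InfinitePlace L // IsComplex w})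
  [∀ w : {w : InfinitePlace L // IsComplex w}, MeasurableSpace ↥(archLocal L 3 (Matrix.diagonal α) w)]
  [∀ w : {w : InfinitePlace L // IsComplex w}, BorelSpace ↥(archLocal L 3 (Matrix.diagonal α) w)]
  [∀ w : {w : InfinitePlace L // IsComplex w}, LocallyCompactSpace ↥(archLocal L 3 (Matrix.diagonal α) w)]
  [∀ w : {w : InfinitePlace L // IsComplex w}, SecondCountableTopology ↥(archLocal L 3 (Matrix.diagonal α) w)]
  [MeasurableSpace ↥(arch (↥(maximalRealSubfield L)) L (IsCMField.complexConj L) 3 (Matrix.diagonal α))]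
  [BorelSpace ↥(arch (↥(maximalRealSubfield L)) L (IsCMField.complexConj L) 3 (Matrix.diagonal α))]
  [∀ w : {w : InfinitePlace L // IsComplex w}, MeasurableSpace (↥(archLocal L 3 (Matrix.diagonal α) w) ⧸ chartTorusGLoc L α w S')]
  [∀ w : {w : InfinitePlace L // IsComplex w}, BorelSpace (↥(archLocal L 3 (Matrix.diagonal α) w) ⧸ chartTorusGLoc L α w S')]
  (ν'w : ∀ w : {w : InfinitePlace L // IsComplex w}, Measure ↥(archLocal L 3 (Matrix.diagonal α) w)) [∀ w, (ν'w w).IsHaarMeasure] [∀ w, (ν'w w).IsMulRightInvariant]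
  (ν' : Measure ↥(arch (↥(maximalRealSubfield L)) L (IsCMField.complexConj L) 3 (Matrix.diagonal α))) [ν'.IsHaarMeasure] [ν'.IsMulRightInvariant]
  (hν : ν' = (Measure.pi ν'w).map (archPiEquivCM 3 L (Matrix.diagonal α)).symm)
  (t : ∀ w : {w : InfinitePlace L // IsComplex w}, Measure ↥(chartTorusGLoc L α w S')) [∀ w, (t w).IsHaarMeasure] [∀ w, (t w).IsInvInvariant]
  -- the compact factor (as in ★ (A1) §3 ∕ ★ (A5a))
  [MeasurableSpace ((∀ w : {w : {w : InfinitePlace L // IsComplex w} // w ∉ S'}, ↥(archLocal L 3 (Matrix.diagonal α) w.1)) ⧸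
    Subgroup.pi Set.univ (fun w : {w : {w : InfinitePlace L // IsComplex w} // w ∉ S'} => chartTorusGLoc L α w.1 S'))]
  [BorelSpace ((∀ w : {w : {w : InfinitePlace L // IsComplex w} // w ∉ S'}, ↥(archLocal L 3 (Matrix.diagonal α) w.1)) ⧸
    Subgroup.pi Set.univ (fun w : {w : {w : InfinitePlace L // IsComplex w} // w ∉ S'} => chartTorusGLoc L α w.1 S'))]
  (ρcpt : Measure ↥(Subgroup.pi Set.univ (fun w : {w : {w : InfinitePlace L // IsComplex w} // w ∉ S'} => chartTorusGLoc L α w.1 S')))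
  [ρcpt.IsHaarMeasure] [ρcpt.IsInvInvariant]
  (hρ : Measure.map (subgroupPiCoords fun w : {w : {w : InfinitePlace L // IsComplex w} // w ∉ S'} => chartTorusGLoc L α w.1 S') ρcpt =
    Measure.pi fun w : {w : {w : InfinitePlace L // IsComplex w} // w ∉ S'} => t w.1)
  -- the standard split group `U(J₃)(ℂ)` and the per-place transports (★ (A2))
  {J : Matrix (Fin 3) (Fin 3) ℂ} (hJ : J = (StdForm.antidiagonal 3).over ℂ)
  [MeasurableSpace ↥(unitaryGroupOfForm (starRingEnd ℂ) J)] [BorelSpace ↥(unitaryGroupOfForm (starRingEnd ℂ) J)]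
  [MeasurableSpace (↥(unitaryGroupOfForm (starRingEnd ℂ) J) ⧸ torusU (starRingEnd ℂ) J)] [BorelSpace (↥(unitaryGroupOfForm (starRingEnd ℂ) J) ⧸ torusU (starRingEnd ℂ) J)]
  (φ : ∀ w : {w : {w : InfinitePlace L // IsComplex w} // w ∈ S'}, ↥(archLocal L 3 (Matrix.diagonal α) w.1) ≃ₜ* ↥(unitaryGroupOfForm (starRingEnd ℂ) J))
  (hφT : ∀ (w : {w : {w : InfinitePlace L // IsComplex w} // w ∈ S'}) (g : ↥(archLocal L 3 (Matrix.diagonal α) w.1)),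
    (φ w).toMulEquiv g ∈ torusU (starRingEnd ℂ) J ↔ g ∈ chartTorusGLoc L α w.1 S')
  (hφγ : ∀ (w : {w : {w : InfinitePlace L // IsComplex w} // w ∈ S'}) (cw : Fin 3 → ℝ), φ w (gprimeBlockAt L α w.1 S' cw) ∈ torusU (starRingEnd ℂ) J)
  (hφd : ∀ (w : {w : {w : InfinitePlace L // IsComplex w} // w ∈ S'}) (cw : Fin 3 → ℝ),
    glDiagonal 3 ℂ (fun i => Units.mk0 (boostEig cw i) (boostEig_ne_zero cw i)) = ((φ w (gprimeBlockAt L α w.1 S' cw) : ↥(unitaryGroupOfForm (starRingEnd ℂ) J)) : GL (Fin 3) ℂ))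
  {K : Subgroup ↥(unitaryGroupOfForm (starRingEnd ℂ) J)} (κ : Measure ↥K) [SigmaFinite κ]
  (μN : Measure ↥(unipotentU (starRingEnd ℂ) J)) [IsHaarMeasure μN]
  {C : {w : {w : InfinitePlace L // IsComplex w} // w ∈ S'} → ℝ≥0}
  (hμC : ∀ w : {w : {w : InfinitePlace L // IsComplex w} // w ∈ S'},
    (quotientMeasure (chartTorusGLoc L α w.1 S') (t w.1) (isClosed_chartTorusGLoc L α w.1 S') (ν'w w.1)).map
        (cosetCongr (φ w).toMulEquiv (chartTorusGLoc L α w.1 S') (torusU (starRingEnd ℂ) J) (hφT w)) =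
      C w • Measure.map
        (fun p : ↥K × ↥(unipotentU (starRingEnd ℂ) J) =>
          (QuotientGroup.mk ((p.1 : ↥(unitaryGroupOfForm (starRingEnd ℂ) J)) * (p.2 : ↥(unitaryGroupOfForm (starRingEnd ℂ) J))) :
            ↥(unitaryGroupOfForm (starRingEnd ℂ) J) ⧸ torusU (starRingEnd ℂ) J))
        (κ.prod μN))
  -- the boost torus family on `U(J₃)(ℂ)` (★ `exists_torusU_boostEig_family`)
  (τ : (Fin 3 → ℝ) → ↥(unitaryGroupOfForm (starRingEnd ℂ) J)) (hτT : ∀ c, τ c ∈ torusU (starRingEnd ℂ) J)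
  (hτcoe : ∀ c, (((τ c : ↥(unitaryGroupOfForm (starRingEnd ℂ) J)) : GL (Fin 3) ℂ) : Matrix (Fin 3) (Fin 3) ℂ) = Matrix.diagonal (boostEig c))
  (hτmul : ∀ c c', τ (c + c') = τ c * τ c')
  (hτd : ∀ c, ∃ d : Fin 3 → ℂˣ, glDiagonal 3 ℂ d = ((τ c : ↥(unitaryGroupOfForm (starRingEnd ℂ) J)) : GL (Fin 3) ℂ) ∧ ∀ i, (d i : ℂ) = boostEig c i)

include hν hρ hJ hφT hφd hμC hτT hτcoe hτmul hτd in
set_option maxHeartbeats 800000 in -- the `whnf` of the 60-line statement + the measure-preserving re-reading exceeds the default 200000 (no `decide`, no search)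
/-- **(J2-a) — (A5a) WITH ONE COMPACT PLACE `w₀ ∉ S′` ISOLATED, BINDER FORM.**  Under the `Integrable` binder `hint` of the final integrand (the iterated integral needs it; the change
of variables does not), for `c ∈ RegG S′`:
`orbFamG ν′ a′ S′ c = (cpt factors) · (∏ t_w(B′_w)) · (∏ C_w) · ρ_cpt(Π T′)⁻¹ · ∫_{U_{w₀}} ( ∫ a′(e⁻¹(w ↦ [w ∈ S′] φ_w⁻¹(k_w·τ(0,φ,θ)τ(x∕2,0,0)·n_w·τ(x∕2,0,0)·k_w⁻¹) ∣ [w ∉ S′] (ASM(g·γ_{w₀}(c)·g⁻¹, (r_{w′}·γ_{w′}(c)·r_{w′}⁻¹)_{w′}))_w)) d((⊗_{S′} κ⊗μ_N) ⊗ (⊗_{w∉S′, w≠w₀} ν′_w)) ) dν′_{w₀}(g)`,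
`γ_w(c) = gprimeBlock L α w S′ c`, `ASM` = Mathlib `piEquivPiSubtypeProd (· = ⟨w₀, _⟩)` + `piUnique` on the compact-place groups (the (J-iso) assembly shape).  ★ (A5a) ∘ ★
`quotientMeasure_eq_inv_smul_map_mk` (all `T′_w`, `w ∉ S′`, compact) ∘ the one-place split ∘ Fubini.
[cite: Rogawski1990, §4.9 (4.9.1)–(4.9.2) p. 55; §8.2 p. 122; §8.3 p. 124] [cite: Folland1995, §2.6 Thm. 2.49, (2.52)] [cite: BorelJacquet1979, §4.1] [cite: DeitmarEchterhoff2014, Thm. 1.5.3; Lemma 9.3.3] -/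
theorem orbFamG_eq_unfoldedModel_group_isolate (hα : ∀ i, α i ≠ 0) (hS' : ∀ w, w ∈ S' → w ∈ splitChartPlaces L α)
    (a' : ↥(arch (↥(maximalRealSubfield L)) L (IsCMField.complexConj L) 3 (Matrix.diagonal α)) → ℂ) (ha'c : Continuous a')
    {c : {w : InfinitePlace L // IsComplex w} → Fin 3 → ℝ} (hc : c ∈ RegG S')
    {w₀ : {w : InfinitePlace L // IsComplex w}} (hw₀ : w₀ ∉ S')
    (hint : Integrable (fun z : ↥(archLocal L 3 (Matrix.diagonal α) w₀) ×
        (({w : {w : InfinitePlace L // IsComplex w} // w ∈ S'} → ↥K × ↥(unipotentU (starRingEnd ℂ) J)) ×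
          (∀ w' : {w' : {w : {w : InfinitePlace L // IsComplex w} // w ∉ S'} // ¬ w' = ⟨w₀, hw₀⟩}, ↥(archLocal L 3 (Matrix.diagonal α) w'.1.1))) =>
        a' ((archPiEquivCM 3 L (Matrix.diagonal α)).symm fun w =>
          if h : w ∈ S' then
            (φ ⟨w, h⟩).symm (((z.2.1 ⟨w, h⟩).1 : ↥(unitaryGroupOfForm (starRingEnd ℂ) J)) *
              (τ ![0, c w 1, c w 2] * τ ![c w 0 / 2, 0, 0] * ((z.2.1 ⟨w, h⟩).2 : ↥(unitaryGroupOfForm (starRingEnd ℂ) J)) * τ ![c w 0 / 2, 0, 0]) *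
              ((z.2.1 ⟨w, h⟩).1 : ↥(unitaryGroupOfForm (starRingEnd ℂ) J))⁻¹)
          else
            (MeasurableEquiv.piEquivPiSubtypeProd
                (fun w' : {w : {w : InfinitePlace L // IsComplex w} // w ∉ S'} => ↥(archLocal L 3 (Matrix.diagonal α) w'.1))
                (· = (⟨w₀, hw₀⟩ : {w : {w : InfinitePlace L // IsComplex w} // w ∉ S'}))).symm
              ((MeasurableEquiv.piUnique fun i : {w' : {w : {w : InfinitePlace L // IsComplex w} // w ∉ S'} // w' = ⟨w₀, hw₀⟩} =>
                  ↥(archLocal L 3 (Matrix.diagonal α) i.1.1)).symm (z.1 * gprimeBlock L α w₀ S' c * z.1⁻¹),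
                fun w' => z.2.2 w' * gprimeBlock L α w'.1.1 S' c * (z.2.2 w')⁻¹) ⟨w, h⟩))
      ((ν'w w₀).prod ((Measure.pi fun _ : {w : {w : InfinitePlace L // IsComplex w} // w ∈ S'} => κ.prod μN).prod
        (Measure.pi fun w' : {w' : {w : {w : InfinitePlace L // IsComplex w} // w ∉ S'} // ¬ w' = ⟨w₀, hw₀⟩} => ν'w w'.1.1)))) :
    orbFamG L α ν' a' S' c =
      (∏ w ∈ Finset.univ.filter (fun w => w ∉ S'),
          ((1 - (Circle.exp (c w 1 - c w 0) : ℂ)) * (1 - (Circle.exp (c w 2 - c w 0) : ℂ)) * (1 - (Circle.exp (c w 2 - c w 1) : ℂ)))) *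
        (∏ w, ((t w (chartBoxImgGLoc L α w S')).toReal : ℂ)) * ((∏ w : {w : {w : InfinitePlace L // IsComplex w} // w ∈ S'}, (C w : ℝ) : ℝ) : ℂ) *
        (((ρcpt Set.univ).toReal)⁻¹ : ℝ) *
        ∫ g : ↥(archLocal L 3 (Matrix.diagonal α) w₀),
          (∫ p : ({w : {w : InfinitePlace L // IsComplex w} // w ∈ S'} → ↥K × ↥(unipotentU (starRingEnd ℂ) J)) ×
              (∀ w' : {w' : {w : {w : InfinitePlace L // IsComplex w} // w ∉ S'} // ¬ w' = ⟨w₀, hw₀⟩}, ↥(archLocal L 3 (Matrix.diagonal α) w'.1.1)),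
            a' ((archPiEquivCM 3 L (Matrix.diagonal α)).symm fun w =>
              if h : w ∈ S' then
                (φ ⟨w, h⟩).symm (((p.1 ⟨w, h⟩).1 : ↥(unitaryGroupOfForm (starRingEnd ℂ) J)) *
                  (τ ![0, c w 1, c w 2] * τ ![c w 0 / 2, 0, 0] * ((p.1 ⟨w, h⟩).2 : ↥(unitaryGroupOfForm (starRingEnd ℂ) J)) * τ ![c w 0 / 2, 0, 0]) *
                  ((p.1 ⟨w, h⟩).1 : ↥(unitaryGroupOfForm (starRingEnd ℂ) J))⁻¹)
              else
                (MeasurableEquiv.piEquivPiSubtypeProd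
                    (fun w' : {w : {w : InfinitePlace L // IsComplex w} // w ∉ S'} => ↥(archLocal L 3 (Matrix.diagonal α) w'.1))
                    (· = (⟨w₀, hw₀⟩ : {w : {w : InfinitePlace L // IsComplex w} // w ∉ S'}))).symm
                  ((MeasurableEquiv.piUnique fun i : {w' : {w : {w : InfinitePlace L // IsComplex w} // w ∉ S'} // w' = ⟨w₀, hw₀⟩} =>
                      ↥(archLocal L 3 (Matrix.diagonal α) i.1.1)).symm (g * gprimeBlock L α w₀ S' c * g⁻¹),
                    fun w' => p.2 w' * gprimeBlock L α w'.1.1 S' c * (p.2 w')⁻¹) ⟨w, h⟩)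
            ∂((Measure.pi fun _ : {w : {w : InfinitePlace L // IsComplex w} // w ∈ S'} => κ.prod μN).prod
              (Measure.pi fun w' : {w' : {w : {w : InfinitePlace L // IsComplex w} // w ∉ S'} // ¬ w' = ⟨w₀, hw₀⟩} => ν'w w'.1.1)))
          ∂(ν'w w₀) := by
  -- ══ the (A5a) integrand on `(S′ → K × N) × ((Π_{w∉S′} U_w) ⧸ Π T′)` (a local `set`; no definition) ══
  set F : (({w : {w : InfinitePlace L // IsComplex w} // w ∈ S'} → ↥K × ↥(unipotentU (starRingEnd ℂ) J)) × ((∀ w : {w : {w : InfinitePlace L // IsComplex w} // w ∉ S'}, ↥(archLocal L 3 (Matrix.diagonal α) w.1)) ⧸ (Subgroup.pi Set.univ (fun w : {w : {w : InfinitePlace L // IsComplex w} // w ∉ S'} => chartTorusGLoc L α w.1 S')))) → ℂ :=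
    fun q => a' ((archPiEquivCM 3 L (Matrix.diagonal α)).symm fun w =>
      if h : w ∈ S' then
        (φ ⟨w, h⟩).symm (((q.1 ⟨w, h⟩).1 : ↥(unitaryGroupOfForm (starRingEnd ℂ) J)) *
              (τ ![0, c w 1, c w 2] * τ ![c w 0 / 2, 0, 0] * ((q.1 ⟨w, h⟩).2 : ↥(unitaryGroupOfForm (starRingEnd ℂ) J)) * τ ![c w 0 / 2, 0, 0]) *
              ((q.1 ⟨w, h⟩).1 : ↥(unitaryGroupOfForm (starRingEnd ℂ) J))⁻¹)
      else
        descConj (fun w : {w : {w : InfinitePlace L // IsComplex w} // w ∉ S'} => gprimeBlock L α w.1 S' c) (Subgroup.pi Set.univ (fun w : {w : {w : InfinitePlace L // IsComplex w} // w ∉ S'} => chartTorusGLoc L α w.1 S'))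
          (forall_mem_piNotMem_chartTorusGLoc_comm L α S' c) (fun g => (g ⟨w, h⟩ : ↥(archLocal L 3 (Matrix.diagonal α) w))) q.2) with hF
  have hMc : IsClosed ((Subgroup.pi Set.univ (fun w : {w : {w : InfinitePlace L // IsComplex w} // w ∉ S'} => chartTorusGLoc L α w.1 S')) : Set (∀ w : {w : {w : InfinitePlace L // IsComplex w} // w ∉ S'}, ↥(archLocal L 3 (Matrix.diagonal α) w.1))) := isClosed_coe_pi _ fun w => isClosed_chartTorusGLoc L α w.1 S'
  rw [orbFamG_eq_unfoldedModel_of_regG L α S' ν'w ν' hν t ρcpt hρ hJ φ hφT hφd κ μN hμC τ hτT hτcoe hτmul hτd hα hS' a' ha'c hc]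
  -- ══ instances (as in ★ (A1) §3 ∕ ★ (A5a)) ══
  haveI : ∀ w : {w : InfinitePlace L // IsComplex w}, SecondCountableTopology (↥(archLocal L 3 (Matrix.diagonal α) w) ⧸ chartTorusGLoc L α w S') := fun w => inferInstance
  haveI : LocallyCompactSpace ↥(Subgroup.pi Set.univ (fun w : {w : {w : InfinitePlace L // IsComplex w} // w ∉ S'} => chartTorusGLoc L α w.1 S')) := hMc.isClosedEmbedding_subtypeVal.locallyCompactSpace
  haveI : SecondCountableTopology ↥(Subgroup.pi Set.univ (fun w : {w : {w : InfinitePlace L // IsComplex w} // w ∉ S'} => chartTorusGLoc L α w.1 S')) := TopologicalSpace.Subtype.secondCountableTopology _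
  haveI : SFinite ρcpt := inferInstance
  have hN : IsClosed (unipotentU (starRingEnd ℂ) J : Set ↥(unitaryGroupOfForm (starRingEnd ℂ) J)) := LineRing.isClosed_unipotentU _ _
  haveI hUJ : LocallyCompactSpace ↥(unitaryGroupOfForm (starRingEnd ℂ) J) := locallyCompactSpace_unitaryGroupOfForm_complex J
  haveI : SecondCountableTopology ↥(unitaryGroupOfForm (starRingEnd ℂ) J) := secondCountableTopology_unitaryGroupOfForm_complex J
  haveI : LocallyCompactSpace ↥(unipotentU (starRingEnd ℂ) J) := hN.isClosedEmbedding_subtypeVal.locallyCompactSpace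
  haveI : SecondCountableTopology ↥(unipotentU (starRingEnd ℂ) J) := TopologicalSpace.Subtype.secondCountableTopology _
  haveI : BorelSpace ↥(unipotentU (starRingEnd ℂ) J) := Subtype.borelSpace _
  haveI : SecondCountableTopology ↥K := TopologicalSpace.Subtype.secondCountableTopology _
  haveI : BorelSpace ↥K := Subtype.borelSpace _
  haveI : BorelSpace (↥K × ↥(unipotentU (starRingEnd ℂ) J)) := Prod.borelSpace
  haveI : SigmaFinite (κ.prod μN) := inferInstance
  haveI : SecondCountableTopology ((∀ w : {w : {w : InfinitePlace L // IsComplex w} // w ∉ S'}, ↥(archLocal L 3 (Matrix.diagonal α) w.1)) ⧸ (Subgroup.pi Set.univ (fun w : {w : {w : InfinitePlace L // IsComplex w} // w ∉ S'} => chartTorusGLoc L α w.1 S'))) := inferInstance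
  haveI : BorelSpace (({w : {w : InfinitePlace L // IsComplex w} // w ∈ S'} → ↥K × ↥(unipotentU (starRingEnd ℂ) J)) × ((∀ w : {w : {w : InfinitePlace L // IsComplex w} // w ∉ S'}, ↥(archLocal L 3 (Matrix.diagonal α) w.1)) ⧸ (Subgroup.pi Set.univ (fun w : {w : {w : InfinitePlace L // IsComplex w} // w ∉ S'} => chartTorusGLoc L α w.1 S')))) := Prod.borelSpace
  haveI : ∀ w : {w : {w : InfinitePlace L // IsComplex w} // w ∉ S'}, SigmaFinite (ν'w w.1) := fun w => inferInstance
  -- the compact-place tori are compact, hence so is `Π_{w∉S′} T′_w`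
  haveI : CompactSpace ↥(Subgroup.pi Set.univ (fun w : {w : {w : InfinitePlace L // IsComplex w} // w ∉ S'} => chartTorusGLoc L α w.1 S')) := isCompact_iff_compactSpace.mp
    ((isCompact_univ_pi fun w : {w : {w : InfinitePlace L // IsComplex w} // w ∉ S'} => (isCompact_iff_compactSpace.mpr (compactSpace_chartTorusGLoc_of_not_mem L α w.1 S' hα hS' w.2) :
        IsCompact (chartTorusGLoc L α w.1 S' : Set ↥(archLocal L 3 (Matrix.diagonal α) w.1)))).of_isClosed_subset hMc
      fun x hx w _ => (Subgroup.mem_pi _).1 hx w (Set.mem_univ _))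
  -- ══ step 1: unfold the compact quotient — `μ_{Π U ⧸ Π T′} = ρ_cpt(Π T′)⁻¹ • π_* (⊗ ν′_w)` ══
  have hmk : Measurable (QuotientGroup.mk : (∀ w : {w : {w : InfinitePlace L // IsComplex w} // w ∉ S'}, ↥(archLocal L 3 (Matrix.diagonal α) w.1)) → (∀ w : {w : {w : InfinitePlace L // IsComplex w} // w ∉ S'}, ↥(archLocal L 3 (Matrix.diagonal α) w.1)) ⧸ (Subgroup.pi Set.univ (fun w : {w : {w : InfinitePlace L // IsComplex w} // w ∉ S'} => chartTorusGLoc L α w.1 S'))) := QuotientGroup.continuous_mk.measurable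
  have hQ : quotientMeasure (Subgroup.pi Set.univ (fun w : {w : {w : InfinitePlace L // IsComplex w} // w ∉ S'} => chartTorusGLoc L α w.1 S')) ρcpt hMc (Measure.pi fun w : {w : {w : InfinitePlace L // IsComplex w} // w ∉ S'} => ν'w w.1) = (ρcpt Set.univ)⁻¹ • Measure.map QuotientGroup.mk (Measure.pi fun w : {w : {w : InfinitePlace L // IsComplex w} // w ∉ S'} => ν'w w.1) :=
    quotientMeasure_eq_inv_smul_map_mk _ ρcpt _
  have hprod : (Measure.pi fun _ : {w : {w : InfinitePlace L // IsComplex w} // w ∈ S'} => κ.prod μN).prod (quotientMeasure (Subgroup.pi Set.univ (fun w : {w : {w : InfinitePlace L // IsComplex w} // w ∉ S'} => chartTorusGLoc L α w.1 S')) ρcpt hMc (Measure.pi fun w : {w : {w : InfinitePlace L // IsComplex w} // w ∉ S'} => ν'w w.1)) =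
      (ρcpt Set.univ)⁻¹ • Measure.map (Prod.map id (QuotientGroup.mk : (∀ w : {w : {w : InfinitePlace L // IsComplex w} // w ∉ S'}, ↥(archLocal L 3 (Matrix.diagonal α) w.1)) → (∀ w : {w : {w : InfinitePlace L // IsComplex w} // w ∉ S'}, ↥(archLocal L 3 (Matrix.diagonal α) w.1)) ⧸ (Subgroup.pi Set.univ (fun w : {w : {w : InfinitePlace L // IsComplex w} // w ∉ S'} => chartTorusGLoc L α w.1 S')))) ((Measure.pi fun _ : {w : {w : InfinitePlace L // IsComplex w} // w ∈ S'} => κ.prod μN).prod (Measure.pi fun w : {w : {w : InfinitePlace L // IsComplex w} // w ∉ S'} => ν'w w.1)) := by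
    rw [hQ, Measure.prod_smul_right, ← Measure.map_prod_map _ _ measurable_id hmk, Measure.map_id]
  -- the (A5a) integrand is continuous (hence strongly measurable)
  have hFc : Continuous F := by
    refine ha'c.comp ((archPiEquivCM 3 L (Matrix.diagonal α)).symm.continuous.comp (continuous_pi fun w => ?_))
    by_cases h : w ∈ S'
    · simp only [dif_pos h]
      have hk : Continuous fun q : ({w : {w : InfinitePlace L // IsComplex w} // w ∈ S'} → ↥K × ↥(unipotentU (starRingEnd ℂ) J)) × ((∀ w : {w : {w : InfinitePlace L // IsComplex w} // w ∉ S'}, ↥(archLocal L 3 (Matrix.diagonal α) w.1)) ⧸ (Subgroup.pi Set.univ (fun w : {w : {w : InfinitePlace L // IsComplex w} // w ∉ S'} => chartTorusGLoc L α w.1 S'))) => (((q.1 ⟨w, h⟩).1 : ↥(unitaryGroupOfForm (starRingEnd ℂ) J))) :=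
        continuous_subtype_val.comp (continuous_fst.comp ((continuous_apply _).comp continuous_fst))
      have hn : Continuous fun q : ({w : {w : InfinitePlace L // IsComplex w} // w ∈ S'} → ↥K × ↥(unipotentU (starRingEnd ℂ) J)) × ((∀ w : {w : {w : InfinitePlace L // IsComplex w} // w ∉ S'}, ↥(archLocal L 3 (Matrix.diagonal α) w.1)) ⧸ (Subgroup.pi Set.univ (fun w : {w : {w : InfinitePlace L // IsComplex w} // w ∉ S'} => chartTorusGLoc L α w.1 S'))) => (((q.1 ⟨w, h⟩).2 : ↥(unitaryGroupOfForm (starRingEnd ℂ) J))) :=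
        continuous_subtype_val.comp (continuous_snd.comp ((continuous_apply _).comp continuous_fst))
      exact (φ ⟨w, h⟩).symm.continuous.comp ((hk.mul (((continuous_const.mul continuous_const).mul hn).mul continuous_const)).mul hk.inv)
    · simp only [dif_neg h]
      exact (continuous_descConj _ _ _ (continuous_apply _)).comp continuous_snd
  rw [show (∫ q, a' ((archPiEquivCM 3 L (Matrix.diagonal α)).symm fun w =>
      if h : w ∈ S' then
        (φ ⟨w, h⟩).symm (((q.1 ⟨w, h⟩).1 : ↥(unitaryGroupOfForm (starRingEnd ℂ) J)) *
              (τ ![0, c w 1, c w 2] * τ ![c w 0 / 2, 0, 0] * ((q.1 ⟨w, h⟩).2 : ↥(unitaryGroupOfForm (starRingEnd ℂ) J)) * τ ![c w 0 / 2, 0, 0]) *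
              ((q.1 ⟨w, h⟩).1 : ↥(unitaryGroupOfForm (starRingEnd ℂ) J))⁻¹)
      else
        descConj (fun w : {w : {w : InfinitePlace L // IsComplex w} // w ∉ S'} => gprimeBlock L α w.1 S' c) (Subgroup.pi Set.univ (fun w : {w : {w : InfinitePlace L // IsComplex w} // w ∉ S'} => chartTorusGLoc L α w.1 S'))
          (forall_mem_piNotMem_chartTorusGLoc_comm L α S' c) (fun g => (g ⟨w, h⟩ : ↥(archLocal L 3 (Matrix.diagonal α) w))) q.2)
      ∂((Measure.pi fun _ : {w : {w : InfinitePlace L // IsComplex w} // w ∈ S'} => κ.prod μN).prod (quotientMeasure (Subgroup.pi Set.univ (fun w : {w : {w : InfinitePlace L // IsComplex w} // w ∉ S'} => chartTorusGLoc L α w.1 S')) ρcpt hMc (Measure.pi fun w : {w : {w : InfinitePlace L // IsComplex w} // w ∉ S'} => ν'w w.1)))) = ∫ q, F q ∂((Measure.pi fun _ : {w : {w : InfinitePlace L // IsComplex w} // w ∈ S'} => κ.prod μN).prod (quotientMeasure (Subgroup.pi Set.univ (fun w : {w : {w : InfinitePlace L // IsComplex w} // w ∉ S'} => chartTorusGLoc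 L α w.1 S')) ρcpt hMc (Measure.pi fun w : {w : {w : InfinitePlace L // IsComplex w} // w ∉ S'} => ν'w w.1))) from rfl,
    hprod, integral_smul_measure, integral_map (measurable_id.prodMap hmk).aemeasurable hFc.stronglyMeasurable.aestronglyMeasurable]
  -- ══ step 2: the measure-preserving re-reading `(s, g) ↦ (g_{w₀}, (s, (g_w)_{w≠w₀}))` of `(S′→K×N) × Π_{w∉S′} U_w` ══
  set e1 := MeasurableEquiv.piEquivPiSubtypeProd (fun w' : {w : {w : InfinitePlace L // IsComplex w} // w ∉ S'} => ↥(archLocal L 3 (Matrix.diagonal α) w'.1)) (· = (⟨w₀, hw₀⟩ : {w : {w : InfinitePlace L // IsComplex w} // w ∉ S'})) with he1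
  set e2 := MeasurableEquiv.piUnique fun i : {w' : {w : {w : InfinitePlace L // IsComplex w} // w ∉ S'} // w' = ⟨w₀, hw₀⟩} => ↥(archLocal L 3 (Matrix.diagonal α) i.1.1) with he2
  set e12 := e1.trans (e2.prodCongr (MeasurableEquiv.refl (∀ w' : {w' : {w : {w : InfinitePlace L // IsComplex w} // w ∉ S'} // ¬ w' = ⟨w₀, hw₀⟩}, ↥(archLocal L 3 (Matrix.diagonal α) w'.1.1)))) with he12
  set e3 := (MeasurableEquiv.refl ({w : {w : InfinitePlace L // IsComplex w} // w ∈ S'} → ↥K × ↥(unipotentU (starRingEnd ℂ) J))).prodCongr e12 with he3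
  set e4 : (({w : {w : InfinitePlace L // IsComplex w} // w ∈ S'} → ↥K × ↥(unipotentU (starRingEnd ℂ) J)) × (↥(archLocal L 3 (Matrix.diagonal α) w₀) × (∀ w' : {w' : {w : {w : InfinitePlace L // IsComplex w} // w ∉ S'} // ¬ w' = ⟨w₀, hw₀⟩}, ↥(archLocal L 3 (Matrix.diagonal α) w'.1.1)))) ≃ᵐ (↥(archLocal L 3 (Matrix.diagonal α) w₀) × (({w : {w : InfinitePlace L // IsComplex w} // w ∈ S'} → ↥K × ↥(unipotentU (starRingEnd ℂ) J)) × (∀ w' : {w' : {w : {w : InfinitePlace L // IsComplex w} // w ∉ S'} // ¬ w' = ⟨w₀, hw₀⟩}, ↥(archLocal L 3 (Matrix.diagonal α) w'.1.1)))) :=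
    MeasurableEquiv.prodAssoc.symm.trans ((MeasurableEquiv.prodComm.prodCongr (MeasurableEquiv.refl _)).trans MeasurableEquiv.prodAssoc) with he4
  set Ψ := (e3.trans e4).symm with hΨdef
  have hpe1 := measurePreserving_piEquivPiSubtypeProd (fun w : {w : {w : InfinitePlace L // IsComplex w} // w ∉ S'} => ν'w w.1) (· = (⟨w₀, hw₀⟩ : {w : {w : InfinitePlace L // IsComplex w} // w ∉ S'}))
  have hpe2 : MeasurePreserving e2
      (@Measure.pi {w' : {w : {w : InfinitePlace L // IsComplex w} // w ∉ S'} // w' = ⟨w₀, hw₀⟩} (fun i => ↥(archLocal L 3 (Matrix.diagonal α) i.1.1))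
        (Subtype.fintype fun x => x = (⟨w₀, hw₀⟩ : {w : {w : InfinitePlace L // IsComplex w} // w ∉ S'})) (fun i => inferInstance) (fun i => ν'w i.1.1)) (ν'w w₀) := by
    convert measurePreserving_piUnique (fun i : {w' : {w : {w : InfinitePlace L // IsComplex w} // w ∉ S'} // w' = ⟨w₀, hw₀⟩} => ν'w i.1.1) <;>
      exact (congrArg Subtype.val ((default : {w' : {w : {w : InfinitePlace L // IsComplex w} // w ∉ S'} // w' = ⟨w₀, hw₀⟩}).2)).symm
  have hpe12 : MeasurePreserving e12 (Measure.pi fun w : {w : {w : InfinitePlace L // IsComplex w} // w ∉ S'} => ν'w w.1) ((ν'w w₀).prod (Measure.pi fun w' : {w' : {w : {w : InfinitePlace L // IsComplex w} // w ∉ S'} // ¬ w' = ⟨w₀, hw₀⟩} => ν'w w'.1.1)) := hpe1.trans (hpe2.prod (MeasurePreserving.id (Measure.pi fun w' : {w' : {w : {w : InfinitePlace L // IsComplex w} // w ∉ S'} // ¬ w' = ⟨w₀, hw₀⟩} => ν'w w'.1.1)))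
  have hpe3 : MeasurePreserving e3 ((Measure.pi fun _ : {w : {w : InfinitePlace L // IsComplex w} // w ∈ S'} => κ.prod μN).prod (Measure.pi fun w : {w : {w : InfinitePlace L // IsComplex w} // w ∉ S'} => ν'w w.1)) ((Measure.pi fun _ : {w : {w : InfinitePlace L // IsComplex w} // w ∈ S'} => κ.prod μN).prod ((ν'w w₀).prod (Measure.pi fun w' : {w' : {w : {w : InfinitePlace L // IsComplex w} // w ∉ S'} // ¬ w' = ⟨w₀, hw₀⟩} => ν'w w'.1.1))) := (MeasurePreserving.id (Measure.pi fun _ : {w : {w : InfinitePlace L // IsComplex w} // w ∈ S'} => κ.prod μN)).prod hpe12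
  have hpe4 : MeasurePreserving e4 ((Measure.pi fun _ : {w : {w : InfinitePlace L // IsComplex w} // w ∈ S'} => κ.prod μN).prod ((ν'w w₀).prod (Measure.pi fun w' : {w' : {w : {w : InfinitePlace L // IsComplex w} // w ∉ S'} // ¬ w' = ⟨w₀, hw₀⟩} => ν'w w'.1.1))) ((ν'w w₀).prod ((Measure.pi fun _ : {w : {w : InfinitePlace L // IsComplex w} // w ∈ S'} => κ.prod μN).prod (Measure.pi fun w' : {w' : {w : {w : InfinitePlace L // IsComplex w} // w ∉ S'} // ¬ w' = ⟨w₀, hw₀⟩} => ν'w w'.1.1))) :=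
    ((measurePreserving_prodAssoc (Measure.pi fun _ : {w : {w : InfinitePlace L // IsComplex w} // w ∈ S'} => κ.prod μN) (ν'w w₀) (Measure.pi fun w' : {w' : {w : {w : InfinitePlace L // IsComplex w} // w ∉ S'} // ¬ w' = ⟨w₀, hw₀⟩} => ν'w w'.1.1)).symm _).trans
      ((measurePreserving_swap.prod (MeasurePreserving.id (Measure.pi fun w' : {w' : {w : {w : InfinitePlace L // IsComplex w} // w ∉ S'} // ¬ w' = ⟨w₀, hw₀⟩} => ν'w w'.1.1))).trans (measurePreserving_prodAssoc (ν'w w₀) (Measure.pi fun _ : {w : {w : InfinitePlace L // IsComplex w} // w ∈ S'} => κ.prod μN) (Measure.pi fun w' : {w' : {w : {w : InfinitePlace L // IsComplex w} // w ∉ S'} // ¬ w' = ⟨w₀, hw₀⟩} => ν'w w'.1.1)))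
  have hΨ : MeasurePreserving Ψ ((ν'w w₀).prod ((Measure.pi fun _ : {w : {w : InfinitePlace L // IsComplex w} // w ∈ S'} => κ.prod μN).prod (Measure.pi fun w' : {w' : {w : {w : InfinitePlace L // IsComplex w} // w ∉ S'} // ¬ w' = ⟨w₀, hw₀⟩} => ν'w w'.1.1))) ((Measure.pi fun _ : {w : {w : InfinitePlace L // IsComplex w} // w ∈ S'} => κ.prod μN).prod (Measure.pi fun w : {w : {w : InfinitePlace L // IsComplex w} // w ∉ S'} => ν'w w.1)) := (hpe3.trans hpe4).symm
  rw [← hΨ.integral_comp']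
  -- ══ step 3: read the transported integrand: the compact component is the (J-iso) assembly of the conjugated pieces ══
  have hfun : (fun z : ↥(archLocal L 3 (Matrix.diagonal α) w₀) × (({w : {w : InfinitePlace L // IsComplex w} // w ∈ S'} → ↥K × ↥(unipotentU (starRingEnd ℂ) J)) × (∀ w' : {w' : {w : {w : InfinitePlace L // IsComplex w} // w ∉ S'} // ¬ w' = ⟨w₀, hw₀⟩}, ↥(archLocal L 3 (Matrix.diagonal α) w'.1.1))) =>
        F (Prod.map id (QuotientGroup.mk : (∀ w : {w : {w : InfinitePlace L // IsComplex w} // w ∉ S'}, ↥(archLocal L 3 (Matrix.diagonal α) w.1)) → (∀ w : {w : {w : InfinitePlace L // IsComplex w} // w ∉ S'}, ↥(archLocal L 3 (Matrix.diagonal α) w.1)) ⧸ (Subgroup.pi Set.univ (fun w : {w : {w : InfinitePlace L // IsComplex w} // w ∉ S'} => chartTorusGLoc L α w.1 S'))) (Ψ z))) =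
      fun z => a' ((archPiEquivCM 3 L (Matrix.diagonal α)).symm fun w =>
          if h : w ∈ S' then
            (φ ⟨w, h⟩).symm (((z.2.1 ⟨w, h⟩).1 : ↥(unitaryGroupOfForm (starRingEnd ℂ) J)) *
              (τ ![0, c w 1, c w 2] * τ ![c w 0 / 2, 0, 0] * ((z.2.1 ⟨w, h⟩).2 : ↥(unitaryGroupOfForm (starRingEnd ℂ) J)) * τ ![c w 0 / 2, 0, 0]) *
              ((z.2.1 ⟨w, h⟩).1 : ↥(unitaryGroupOfForm (starRingEnd ℂ) J))⁻¹)
          else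
            (MeasurableEquiv.piEquivPiSubtypeProd
                (fun w' : {w : {w : InfinitePlace L // IsComplex w} // w ∉ S'} => ↥(archLocal L 3 (Matrix.diagonal α) w'.1))
                (· = (⟨w₀, hw₀⟩ : {w : {w : InfinitePlace L // IsComplex w} // w ∉ S'}))).symm
              ((MeasurableEquiv.piUnique fun i : {w' : {w : {w : InfinitePlace L // IsComplex w} // w ∉ S'} // w' = ⟨w₀, hw₀⟩} =>
                  ↥(archLocal L 3 (Matrix.diagonal α) i.1.1)).symm (z.1 * gprimeBlock L α w₀ S' c * z.1⁻¹),
                fun w' => z.2.2 w' * gprimeBlock L α w'.1.1 S' c * (z.2.2 w')⁻¹) ⟨w, h⟩) := by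
    funext z
    obtain ⟨g, s, r⟩ := z
    have hΨz : Ψ (g, s, r) = (s, e1.symm (e2.symm g, r)) := rfl
    rw [hΨz]
    simp only [hF, Prod.map_apply, id_eq, descConj_mk]
    congr 2
    funext w
    by_cases h : w ∈ S'
    · rw [dif_pos h, dif_pos h]
    · rw [dif_neg h, dif_neg h, Pi.mul_apply, Pi.mul_apply, Pi.inv_apply, he1, he2,
        piEquivPiSubtypeProd_symm_apply_dite', piEquivPiSubtypeProd_symm_apply_dite']
      by_cases hw : (⟨w, h⟩ : {w : {w : InfinitePlace L // IsComplex w} // w ∉ S'}) = ⟨w₀, hw₀⟩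
      · have hww : w = w₀ := congrArg Subtype.val hw
        subst hww
        rw [dif_pos hw, dif_pos hw]
        erw [piUnique_symm_apply_of_eq' (fun j : {w : {w : InfinitePlace L // IsComplex w} // w ∉ S'} => ↥(archLocal L 3 (Matrix.diagonal α) j.1)) ⟨w, hw₀⟩ g,
          piUnique_symm_apply_of_eq' (fun j : {w : {w : InfinitePlace L // IsComplex w} // w ∉ S'} => ↥(archLocal L 3 (Matrix.diagonal α) j.1)) ⟨w, hw₀⟩ (g * gprimeBlock L α w S' c * g⁻¹)]
      · rw [dif_neg hw, dif_neg hw]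
  rw [hfun, integral_prod _ hint]
  -- ══ constants ══
  rw [Complex.real_smul, ENNReal.toReal_inv]
  push_cast
  ring

end Isolate

end Literature.NumberTheory.Rogawski1990

end
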